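import Summits.Parity.GeneralizedHardyLittlewood.Theorems.GreenTaoLevelTwoMNTwoBracketFrameBasic

/-!
# Route `GreenTaoLevelTwo`, crux `MNTwo` (stmt-Parity-21276), line `birth`, stub `stub_mnVertical`:
# GT 2008b App. A (Prop. 5) — bracket frames of products, powers and the whole vertical class

Block V7 of the `stub_mnVertical` census (B. Green, T. Tao, *Quadratic uniformity of the Möbius
function*, Ann. Inst. Fourier 58 (2008) = arXiv:math/0606087, App. A, Prop. 5, "completely
explicit when the group `G` is a product of Heisenberg groups").  The def-free BRACKET FRAME
proposition of `…MNTwoBracketFrameHeis` is inherited by binary products: in product coordinates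
(`G × G'`, `Γ × Γ'`, max metric; `bracketFrame_prod_coords`) with index set `I ⊕ J`, pieces
`P × Q`, tensor partition `χ_p ⊗ χ_q`, componentwise sections and central parts and constant
`K₁ + K₂` (the centre and the lattice of a product are the products), then for `X.prod Y` by the
transport lemma of `…MNTwoBracketFrameBasic` along the identity (`bracketFrame_prod`); hence by powers
(`bracketFrame_pow`), by every member of the Heisenberg class `𝒞₂(H_d)` (`bracketFrame_of_inHeisClass`,
induction over the class) and by every `X^m × ℝ/ℤ`, `X ∈ 𝒞₂(H_d)` — the nilmanifolds of
`stub_mnVertical` (`bracketFrame_verticalClass`).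

References: [GreenTao2008QuadraticMobius] arXiv:math/0606087, App. A, Prop. 5.
-/

noncomputable section

open Literature.NumberTheory.Sieve
open Literature.NumberTheory.Sieve.GreenTaoLevelTwo (HX IsCompatMetric IsBoxComparable heisenbergWith
  InHeisClass)
open Summit.Parity.GeneralizedHardyLittlewood.GreenTaoLevelTwoMNTwoBracketFrameBasic
open Summit.Parity.GeneralizedHardyLittlewood.GreenTaoLevelTwoMNTwoBracketFrameHeis (bracketFrame_heisenbergWith)

namespace Summit.Parity.GeneralizedHardyLittlewood.GreenTaoLevelTwoMNTwoBracketFrameVertical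

/-! ### §1 Small lemmas -/

/-- Restriction of `u : I ⊕ J → ℝ` to `I` is `1`-Lipschitz for the sup-distances. [folklore] -/
theorem dist_comp_inl_le {I J : Type} [Fintype I] [Fintype J] (u u' : I ⊕ J → ℝ) :
    dist (fun i => u (Sum.inl i)) (fun i => u' (Sum.inl i)) ≤ dist u u' :=
  (dist_pi_le_iff dist_nonneg).mpr fun i => dist_le_pi_dist u u' (Sum.inl i)

/-- Restriction of `u : I ⊕ J → ℝ` to `J` is `1`-Lipschitz for the sup-distances. [folklore] -/
theorem dist_comp_inr_le {I J : Type} [Fintype I] [Fintype J] (u u' : I ⊕ J → ℝ) :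
    dist (fun j => u (Sum.inr j)) (fun j => u' (Sum.inr j)) ≤ dist u u' :=
  (dist_pi_le_iff dist_nonneg).mpr fun j => dist_le_pi_dist u u' (Sum.inr j)

/-- A member of a nonnegative partition of unity is at most `1`. [folklore] -/
theorem le_one_of_sum_eq_one {P : Type} [Fintype P] {χ : P → ℝ} (h0 : ∀ p, 0 ≤ χ p)
    (h1 : ∑ p, χ p = 1) (p : P) : χ p ≤ 1 := by
  rw [← h1]
  exact Finset.single_le_sum (fun q _ => h0 q) (Finset.mem_univ p)

/-- Lipschitz bound for a tensor product of two `[0,1]`-valued functions. [folklore] -/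
theorem abs_mul_sub_mul_le' {a a' b b' A B : ℝ} (ha : 0 ≤ a) (ha1 : a ≤ 1) (hb' : 0 ≤ b')
    (hb1 : b' ≤ 1) (hA : |a - a'| ≤ A) (hB : |b - b'| ≤ B) : |a * b - a' * b'| ≤ A + B := by
  rw [show a * b - a' * b' = a * (b - b') + (a - a') * b' by ring]
  refine (abs_add_le _ _).trans ?_
  rw [abs_mul, abs_mul, abs_of_nonneg ha, abs_of_nonneg hb']
  nlinarith [abs_nonneg (b - b'), abs_nonneg (a - a')]

/-! ### §2 Products -/

/-- **Binary products inherit bracket frames, in product coordinates** (`G × G'`, `Γ × Γ'`, max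
metric): index set `I ⊕ J`, pieces `P × Q`, tensor partition, componentwise sections and central
parts, constant `K₁ + K₂`. [cite: GreenTao2008QuadraticMobius, App. A, Prop. 5 (products of Heisenberg groups)] -/
theorem bracketFrame_prod_coords {s : ℕ} (X Y : Nilmanifold s)
    (hX : ∃ (I : Type) (_ : Fintype I) (P : Type) (_ : Fintype P)
        (π : (X).G → (I → ℝ)) (χ : P → (I → ℝ) → ℝ) (σ : P → (I → ℝ) → (X).G)
        (ζ : P → (X).G → (X).G) (K : ℝ), 0 ≤ K ∧
        (∀ g g' : (X).G, π (g * g') = π g + π g') ∧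
        (∀ p u, 0 ≤ χ p u) ∧
        (∀ u, ∑ p, χ p u = 1) ∧
        (∀ p u (v : I → ℤ), χ p (u + fun i => (v i : ℝ)) = χ p u) ∧
        (∀ p u u', |χ p u - χ p u'| ≤ K * dist u u') ∧
        (∀ p u (v : I → ℤ), ∃ γ ∈ (X).Γ, σ p (u + fun i => (v i : ℝ)) = σ p u * γ) ∧
        (∀ p u u', dist u u' ≤ 1 →
          (X).dist (σ p u : (X).G ⧸ (X).Γ) (σ p u' : (X).G ⧸ (X).Γ) ≤ K * dist u u') ∧
        (∀ p w, ζ p w ∈ Subgroup.center (X).G) ∧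
        (∀ p w, χ p (π w) ≠ 0 → ∃ γ ∈ (X).Γ, w = ζ p w * σ p (π w) * γ) ∧
        (∀ p (g x₀ : (X).G) (n h₁ h₂ h₃ : ℤ),
          (∀ e₁ e₂ e₃ : ℕ, e₁ ≤ 1 → e₂ ≤ 1 → e₃ ≤ 1 →
            χ p (π (g ^ (n + e₁ * h₁ + e₂ * h₂ + e₃ * h₃) * x₀)) ≠ 0) →
          ζ p (g ^ (n + h₁ + h₂ + h₃) * x₀) * (ζ p (g ^ (n + h₁ + h₂) * x₀))⁻¹ *
            (ζ p (g ^ (n + h₁ + h₃) * x₀))⁻¹ * (ζ p (g ^ (n + h₂ + h₃) * x₀))⁻¹ *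
            ζ p (g ^ (n + h₁) * x₀) * ζ p (g ^ (n + h₂) * x₀) * ζ p (g ^ (n + h₃) * x₀) *
            (ζ p (g ^ n * x₀))⁻¹ = 1))
    (hY : ∃ (I : Type) (_ : Fintype I) (P : Type) (_ : Fintype P)
        (π : (Y).G → (I → ℝ)) (χ : P → (I → ℝ) → ℝ) (σ : P → (I → ℝ) → (Y).G)
        (ζ : P → (Y).G → (Y).G) (K : ℝ), 0 ≤ K ∧
        (∀ g g' : (Y).G, π (g * g') = π g + π g') ∧
        (∀ p u, 0 ≤ χ p u) ∧
        (∀ u, ∑ p, χ p u = 1) ∧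
        (∀ p u (v : I → ℤ), χ p (u + fun i => (v i : ℝ)) = χ p u) ∧
        (∀ p u u', |χ p u - χ p u'| ≤ K * dist u u') ∧
        (∀ p u (v : I → ℤ), ∃ γ ∈ (Y).Γ, σ p (u + fun i => (v i : ℝ)) = σ p u * γ) ∧
        (∀ p u u', dist u u' ≤ 1 →
          (Y).dist (σ p u : (Y).G ⧸ (Y).Γ) (σ p u' : (Y).G ⧸ (Y).Γ) ≤ K * dist u u') ∧
        (∀ p w, ζ p w ∈ Subgroup.center (Y).G) ∧
        (∀ p w, χ p (π w) ≠ 0 → ∃ γ ∈ (Y).Γ, w = ζ p w * σ p (π w) * γ) ∧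
        (∀ p (g x₀ : (Y).G) (n h₁ h₂ h₃ : ℤ),
          (∀ e₁ e₂ e₃ : ℕ, e₁ ≤ 1 → e₂ ≤ 1 → e₃ ≤ 1 →
            χ p (π (g ^ (n + e₁ * h₁ + e₂ * h₂ + e₃ * h₃) * x₀)) ≠ 0) →
          ζ p (g ^ (n + h₁ + h₂ + h₃) * x₀) * (ζ p (g ^ (n + h₁ + h₂) * x₀))⁻¹ *
            (ζ p (g ^ (n + h₁ + h₃) * x₀))⁻¹ * (ζ p (g ^ (n + h₂ + h₃) * x₀))⁻¹ *
            ζ p (g ^ (n + h₁) * x₀) * ζ p (g ^ (n + h₂) * x₀) * ζ p (g ^ (n + h₃) * x₀) *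
            (ζ p (g ^ n * x₀))⁻¹ = 1)) :
    ∃ (I : Type) (_ : Fintype I) (P : Type) (_ : Fintype P)
        (π : (X.G × Y.G) → (I → ℝ)) (χ : P → (I → ℝ) → ℝ) (σ : P → (I → ℝ) → (X.G × Y.G))
        (ζ : P → (X.G × Y.G) → (X.G × Y.G)) (K : ℝ), 0 ≤ K ∧
        (∀ g g' : (X.G × Y.G), π (g * g') = π g + π g') ∧
        (∀ p u, 0 ≤ χ p u) ∧
        (∀ u, ∑ p, χ p u = 1) ∧
        (∀ p u (v : I → ℤ), χ p (u + fun i => (v i : ℝ)) = χ p u) ∧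
        (∀ p u u', |χ p u - χ p u'| ≤ K * dist u u') ∧
        (∀ p u (v : I → ℤ), ∃ γ ∈ (X.Γ.prod Y.Γ), σ p (u + fun i => (v i : ℝ)) = σ p u * γ) ∧
        (∀ p u u', dist u u' ≤ 1 →
          (X.prod Y).dist (σ p u : (X.G × Y.G) ⧸ (X.Γ.prod Y.Γ)) (σ p u' : (X.G × Y.G) ⧸ (X.Γ.prod Y.Γ)) ≤ K * dist u u') ∧
        (∀ p w, ζ p w ∈ Subgroup.center (X.G × Y.G)) ∧
        (∀ p w, χ p (π w) ≠ 0 → ∃ γ ∈ (X.Γ.prod Y.Γ), w = ζ p w * σ p (π w) * γ) ∧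
        (∀ p (g x₀ : (X.G × Y.G)) (n h₁ h₂ h₃ : ℤ),
          (∀ e₁ e₂ e₃ : ℕ, e₁ ≤ 1 → e₂ ≤ 1 → e₃ ≤ 1 →
            χ p (π (g ^ (n + e₁ * h₁ + e₂ * h₂ + e₃ * h₃) * x₀)) ≠ 0) →
          ζ p (g ^ (n + h₁ + h₂ + h₃) * x₀) * (ζ p (g ^ (n + h₁ + h₂) * x₀))⁻¹ *
            (ζ p (g ^ (n + h₁ + h₃) * x₀))⁻¹ * (ζ p (g ^ (n + h₂ + h₃) * x₀))⁻¹ *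
            ζ p (g ^ (n + h₁) * x₀) * ζ p (g ^ (n + h₂) * x₀) * ζ p (g ^ (n + h₃) * x₀) *
            (ζ p (g ^ n * x₀))⁻¹ = 1) := by
  obtain ⟨I, iI, P, iP, π₁, χ₁, σ₁, ζ₁, K₁, hK₁, hπ₁, hχ0₁, hχ1₁, hχper₁, hχlip₁, hσper₁, hσlip₁,
    hζ₁, hbr₁, hcube₁⟩ := hX
  obtain ⟨J, iJ, Q, iQ, π₂, χ₂, σ₂, ζ₂, K₂, hK₂, hπ₂, hχ0₂, hχ1₂, hχper₂, hχlip₂, hσper₂, hσlip₂,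
    hζ₂, hbr₂, hcube₂⟩ := hY
  refine ⟨I ⊕ J, inferInstance, P × Q, inferInstance,
    fun g => Sum.elim (π₁ g.1) (π₂ g.2),
    fun p u => χ₁ p.1 (fun i => u (Sum.inl i)) * χ₂ p.2 (fun j => u (Sum.inr j)),
    fun p u => (σ₁ p.1 (fun i => u (Sum.inl i)), σ₂ p.2 (fun j => u (Sum.inr j))),
    fun p w => (ζ₁ p.1 w.1, ζ₂ p.2 w.2),
    K₁ + K₂, add_nonneg hK₁ hK₂, fun g g' => ?_, fun p u => mul_nonneg (hχ0₁ _ _) (hχ0₂ _ _),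
    fun u => ?_, fun p u v => ?_, fun p u u' => ?_, fun p u v => ?_, fun p u u' huu' => ?_,
    fun p w => ?_, fun p w hw => ?_, fun p g x₀ n h₁ h₂ h₃ hsupp => ?_⟩
  · -- `π` is a homomorphism
    funext i
    cases i with
    | inl i => simp only [Sum.elim_inl, Pi.add_apply, Prod.fst_mul, hπ₁]
    | inr j => simp only [Sum.elim_inr, Pi.add_apply, Prod.snd_mul, hπ₂]
  · -- partition of unity
    rw [Fintype.sum_prod_type]
    simp only [← Finset.mul_sum, hχ1₂, mul_one, hχ1₁]
  · -- periodicity of `χ`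
    show χ₁ p.1 ((fun i => u (Sum.inl i)) + fun i => ((v (Sum.inl i) : ℤ) : ℝ)) *
        χ₂ p.2 ((fun j => u (Sum.inr j)) + fun j => ((v (Sum.inr j) : ℤ) : ℝ)) = _
    rw [hχper₁, hχper₂]
  · -- Lipschitz bound for `χ`
    have h1 := le_one_of_sum_eq_one (fun q => hχ0₁ q (fun i => u (Sum.inl i))) (hχ1₁ _) p.1
    have h2 := le_one_of_sum_eq_one (fun q => hχ0₂ q (fun j => u' (Sum.inr j))) (hχ1₂ _) p.2
    refine (abs_mul_sub_mul_le' (hχ0₁ _ _) h1 (hχ0₂ _ _) h2 (hχlip₁ p.1 _ _) (hχlip₂ p.2 _ _)).trans ?_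
    have d1 := dist_comp_inl_le u u'
    have d2 := dist_comp_inr_le u u'
    nlinarith
  · -- periodicity of the sections modulo `Γ × Γ'`
    obtain ⟨γ₁, hγ₁, hσ₁⟩ := hσper₁ p.1 (fun i => u (Sum.inl i)) (fun i => v (Sum.inl i))
    obtain ⟨γ₂, hγ₂, hσ₂⟩ := hσper₂ p.2 (fun j => u (Sum.inr j)) (fun j => v (Sum.inr j))
    refine ⟨(γ₁, γ₂), Subgroup.mem_prod.mpr ⟨hγ₁, hγ₂⟩, ?_⟩
    show (σ₁ p.1 ((fun i => u (Sum.inl i)) + fun i => ((v (Sum.inl i) : ℤ) : ℝ)),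
        σ₂ p.2 ((fun j => u (Sum.inr j)) + fun j => ((v (Sum.inr j) : ℤ) : ℝ))) = _
    rw [hσ₁, hσ₂]
    rfl
  · -- Lipschitz bound for the sections in the max metric
    rw [Nilmanifold.prod_dist_eq, Nilmanifold.quotientProdMap_mk, Nilmanifold.quotientProdMap_mk]
    have d1 := dist_comp_inl_le u u'
    have d2 := dist_comp_inr_le u u'
    have e1 := hσlip₁ p.1 _ _ (d1.trans huu')
    have e2 := hσlip₂ p.2 _ _ (d2.trans huu')
    have hd : 0 ≤ dist u u' := dist_nonneg
    exact max_le (e1.trans (by nlinarith)) (e2.trans (by nlinarith))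
  · -- central parts are central
    rw [Subgroup.mem_center_iff]
    intro g
    exact Prod.ext (Subgroup.mem_center_iff.mp (hζ₁ p.1 _) g.1)
      (Subgroup.mem_center_iff.mp (hζ₂ p.2 _) g.2)
  · -- the bracket decomposition, componentwise
    obtain ⟨hw₁, hw₂⟩ := mul_ne_zero_iff.mp hw
    obtain ⟨γ₁, hγ₁, h₁⟩ := hbr₁ p.1 w.1 hw₁
    obtain ⟨γ₂, hγ₂, h₂⟩ := hbr₂ p.2 w.2 hw₂
    exact ⟨(γ₁, γ₂), Subgroup.mem_prod.mpr ⟨hγ₁, hγ₂⟩, Prod.ext h₁ h₂⟩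
  · -- the cube condition, componentwise
    have ev1 : ∀ v : ℤ, (g ^ v).1 = g.1 ^ v := fun v => rfl
    have ev2 : ∀ v : ℤ, (g ^ v).2 = g.2 ^ v := fun v => rfl
    have hs₁ : ∀ e₁ e₂ e₃ : ℕ, e₁ ≤ 1 → e₂ ≤ 1 → e₃ ≤ 1 →
        χ₁ p.1 (π₁ (g.1 ^ (n + e₁ * h₁ + e₂ * h₂ + e₃ * h₃) * x₀.1)) ≠ 0 := by
      intro e₁ e₂ e₃ a b c
      have h' := (mul_ne_zero_iff.mp (hsupp e₁ e₂ e₃ a b c)).1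
      beta_reduce at h'
      simp only [Sum.elim_inl, Prod.fst_mul, ev1] at h'
      exact h'
    have hs₂ : ∀ e₁ e₂ e₃ : ℕ, e₁ ≤ 1 → e₂ ≤ 1 → e₃ ≤ 1 →
        χ₂ p.2 (π₂ (g.2 ^ (n + e₁ * h₁ + e₂ * h₂ + e₃ * h₃) * x₀.2)) ≠ 0 := by
      intro e₁ e₂ e₃ a b c
      have h' := (mul_ne_zero_iff.mp (hsupp e₁ e₂ e₃ a b c)).2
      beta_reduce at h'
      simp only [Sum.elim_inr, Prod.snd_mul, ev2] at h'
      exact h'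
    have k₁ := hcube₁ p.1 g.1 x₀.1 n h₁ h₂ h₃ hs₁
    have k₂ := hcube₂ p.2 g.2 x₀.2 n h₁ h₂ h₃ hs₂
    refine Prod.ext ?_ ?_
    · simp only [Prod.fst_mul, Prod.fst_inv, Prod.fst_one, ev1]
      exact k₁
    · simp only [Prod.snd_mul, Prod.snd_inv, Prod.snd_one, ev2]
      exact k₂

/-- **Binary products inherit bracket frames** (`X.prod Y`, the product nilmanifold with the max
metric). [cite: GreenTao2008QuadraticMobius, App. A, Prop. 5 (products of Heisenberg groups)] -/
theorem bracketFrame_prod {s : ℕ} (X Y : Nilmanifold s)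
    (hX : ∃ (I : Type) (_ : Fintype I) (P : Type) (_ : Fintype P)
        (π : (X).G → (I → ℝ)) (χ : P → (I → ℝ) → ℝ) (σ : P → (I → ℝ) → (X).G)
        (ζ : P → (X).G → (X).G) (K : ℝ), 0 ≤ K ∧
        (∀ g g' : (X).G, π (g * g') = π g + π g') ∧
        (∀ p u, 0 ≤ χ p u) ∧
        (∀ u, ∑ p, χ p u = 1) ∧
        (∀ p u (v : I → ℤ), χ p (u + fun i => (v i : ℝ)) = χ p u) ∧
        (∀ p u u', |χ p u - χ p u'| ≤ K * dist u u') ∧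
        (∀ p u (v : I → ℤ), ∃ γ ∈ (X).Γ, σ p (u + fun i => (v i : ℝ)) = σ p u * γ) ∧
        (∀ p u u', dist u u' ≤ 1 →
          (X).dist (σ p u : (X).G ⧸ (X).Γ) (σ p u' : (X).G ⧸ (X).Γ) ≤ K * dist u u') ∧
        (∀ p w, ζ p w ∈ Subgroup.center (X).G) ∧
        (∀ p w, χ p (π w) ≠ 0 → ∃ γ ∈ (X).Γ, w = ζ p w * σ p (π w) * γ) ∧
        (∀ p (g x₀ : (X).G) (n h₁ h₂ h₃ : ℤ),
          (∀ e₁ e₂ e₃ : ℕ, e₁ ≤ 1 → e₂ ≤ 1 → e₃ ≤ 1 →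
            χ p (π (g ^ (n + e₁ * h₁ + e₂ * h₂ + e₃ * h₃) * x₀)) ≠ 0) →
          ζ p (g ^ (n + h₁ + h₂ + h₃) * x₀) * (ζ p (g ^ (n + h₁ + h₂) * x₀))⁻¹ *
            (ζ p (g ^ (n + h₁ + h₃) * x₀))⁻¹ * (ζ p (g ^ (n + h₂ + h₃) * x₀))⁻¹ *
            ζ p (g ^ (n + h₁) * x₀) * ζ p (g ^ (n + h₂) * x₀) * ζ p (g ^ (n + h₃) * x₀) *
            (ζ p (g ^ n * x₀))⁻¹ = 1))
    (hY : ∃ (I : Type) (_ : Fintype I) (P : Type) (_ : Fintype P)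
        (π : (Y).G → (I → ℝ)) (χ : P → (I → ℝ) → ℝ) (σ : P → (I → ℝ) → (Y).G)
        (ζ : P → (Y).G → (Y).G) (K : ℝ), 0 ≤ K ∧
        (∀ g g' : (Y).G, π (g * g') = π g + π g') ∧
        (∀ p u, 0 ≤ χ p u) ∧
        (∀ u, ∑ p, χ p u = 1) ∧
        (∀ p u (v : I → ℤ), χ p (u + fun i => (v i : ℝ)) = χ p u) ∧
        (∀ p u u', |χ p u - χ p u'| ≤ K * dist u u') ∧
        (∀ p u (v : I → ℤ), ∃ γ ∈ (Y).Γ, σ p (u + fun i => (v i : ℝ)) = σ p u * γ) ∧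
        (∀ p u u', dist u u' ≤ 1 →
          (Y).dist (σ p u : (Y).G ⧸ (Y).Γ) (σ p u' : (Y).G ⧸ (Y).Γ) ≤ K * dist u u') ∧
        (∀ p w, ζ p w ∈ Subgroup.center (Y).G) ∧
        (∀ p w, χ p (π w) ≠ 0 → ∃ γ ∈ (Y).Γ, w = ζ p w * σ p (π w) * γ) ∧
        (∀ p (g x₀ : (Y).G) (n h₁ h₂ h₃ : ℤ),
          (∀ e₁ e₂ e₃ : ℕ, e₁ ≤ 1 → e₂ ≤ 1 → e₃ ≤ 1 →
            χ p (π (g ^ (n + e₁ * h₁ + e₂ * h₂ + e₃ * h₃) * x₀)) ≠ 0) →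
          ζ p (g ^ (n + h₁ + h₂ + h₃) * x₀) * (ζ p (g ^ (n + h₁ + h₂) * x₀))⁻¹ *
            (ζ p (g ^ (n + h₁ + h₃) * x₀))⁻¹ * (ζ p (g ^ (n + h₂ + h₃) * x₀))⁻¹ *
            ζ p (g ^ (n + h₁) * x₀) * ζ p (g ^ (n + h₂) * x₀) * ζ p (g ^ (n + h₃) * x₀) *
            (ζ p (g ^ n * x₀))⁻¹ = 1)) :
    ∃ (I : Type) (_ : Fintype I) (P : Type) (_ : Fintype P)
        (π : (X.prod Y).G → (I → ℝ)) (χ : P → (I → ℝ) → ℝ) (σ : P → (I → ℝ) → (X.prod Y).G)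
        (ζ : P → (X.prod Y).G → (X.prod Y).G) (K : ℝ), 0 ≤ K ∧
        (∀ g g' : (X.prod Y).G, π (g * g') = π g + π g') ∧
        (∀ p u, 0 ≤ χ p u) ∧
        (∀ u, ∑ p, χ p u = 1) ∧
        (∀ p u (v : I → ℤ), χ p (u + fun i => (v i : ℝ)) = χ p u) ∧
        (∀ p u u', |χ p u - χ p u'| ≤ K * dist u u') ∧
        (∀ p u (v : I → ℤ), ∃ γ ∈ (X.prod Y).Γ, σ p (u + fun i => (v i : ℝ)) = σ p u * γ) ∧
        (∀ p u u', dist u u' ≤ 1 →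
          (X.prod Y).dist (σ p u : (X.prod Y).G ⧸ (X.prod Y).Γ) (σ p u' : (X.prod Y).G ⧸ (X.prod Y).Γ) ≤ K * dist u u') ∧
        (∀ p w, ζ p w ∈ Subgroup.center (X.prod Y).G) ∧
        (∀ p w, χ p (π w) ≠ 0 → ∃ γ ∈ (X.prod Y).Γ, w = ζ p w * σ p (π w) * γ) ∧
        (∀ p (g x₀ : (X.prod Y).G) (n h₁ h₂ h₃ : ℤ),
          (∀ e₁ e₂ e₃ : ℕ, e₁ ≤ 1 → e₂ ≤ 1 → e₃ ≤ 1 →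
            χ p (π (g ^ (n + e₁ * h₁ + e₂ * h₂ + e₃ * h₃) * x₀)) ≠ 0) →
          ζ p (g ^ (n + h₁ + h₂ + h₃) * x₀) * (ζ p (g ^ (n + h₁ + h₂) * x₀))⁻¹ *
            (ζ p (g ^ (n + h₁ + h₃) * x₀))⁻¹ * (ζ p (g ^ (n + h₂ + h₃) * x₀))⁻¹ *
            ζ p (g ^ (n + h₁) * x₀) * ζ p (g ^ (n + h₂) * x₀) * ζ p (g ^ (n + h₃) * x₀) *
            (ζ p (g ^ n * x₀))⁻¹ = 1) :=
  bracketFrame_transport (X.prod Y) (X.Γ.prod Y.Γ) (X.prod Y).dist (MulEquiv.refl _)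
    (fun _ => Iff.rfl) (fun _ _ => rfl) (bracketFrame_prod_coords X Y hX hY)

/-! ### §3 Powers, the Heisenberg class, the vertical class -/

/-- **Powers inherit bracket frames** (`X^0` = point, `X^(m+1) = X × X^m`).
[cite: GreenTao2008QuadraticMobius, App. A, Prop. 5 (products of Heisenberg groups)] -/
theorem bracketFrame_pow {s : ℕ} (X : Nilmanifold s)
    (hX : ∃ (I : Type) (_ : Fintype I) (P : Type) (_ : Fintype P)
        (π : (X).G → (I → ℝ)) (χ : P → (I → ℝ) → ℝ) (σ : P → (I → ℝ) → (X).G)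
        (ζ : P → (X).G → (X).G) (K : ℝ), 0 ≤ K ∧
        (∀ g g' : (X).G, π (g * g') = π g + π g') ∧
        (∀ p u, 0 ≤ χ p u) ∧
        (∀ u, ∑ p, χ p u = 1) ∧
        (∀ p u (v : I → ℤ), χ p (u + fun i => (v i : ℝ)) = χ p u) ∧
        (∀ p u u', |χ p u - χ p u'| ≤ K * dist u u') ∧
        (∀ p u (v : I → ℤ), ∃ γ ∈ (X).Γ, σ p (u + fun i => (v i : ℝ)) = σ p u * γ) ∧
        (∀ p u u', dist u u' ≤ 1 →
          (X).dist (σ p u : (X).G ⧸ (X).Γ) (σ p u' : (X).G ⧸ (X).Γ) ≤ K * dist u u') ∧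
        (∀ p w, ζ p w ∈ Subgroup.center (X).G) ∧
        (∀ p w, χ p (π w) ≠ 0 → ∃ γ ∈ (X).Γ, w = ζ p w * σ p (π w) * γ) ∧
        (∀ p (g x₀ : (X).G) (n h₁ h₂ h₃ : ℤ),
          (∀ e₁ e₂ e₃ : ℕ, e₁ ≤ 1 → e₂ ≤ 1 → e₃ ≤ 1 →
            χ p (π (g ^ (n + e₁ * h₁ + e₂ * h₂ + e₃ * h₃) * x₀)) ≠ 0) →
          ζ p (g ^ (n + h₁ + h₂ + h₃) * x₀) * (ζ p (g ^ (n + h₁ + h₂) * x₀))⁻¹ *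
            (ζ p (g ^ (n + h₁ + h₃) * x₀))⁻¹ * (ζ p (g ^ (n + h₂ + h₃) * x₀))⁻¹ *
            ζ p (g ^ (n + h₁) * x₀) * ζ p (g ^ (n + h₂) * x₀) * ζ p (g ^ (n + h₃) * x₀) *
            (ζ p (g ^ n * x₀))⁻¹ = 1)) :
    ∀ m : ℕ, ∃ (I : Type) (_ : Fintype I) (P : Type) (_ : Fintype P)
        (π : (X.pow m).G → (I → ℝ)) (χ : P → (I → ℝ) → ℝ) (σ : P → (I → ℝ) → (X.pow m).G)
        (ζ : P → (X.pow m).G → (X.pow m).G) (K : ℝ), 0 ≤ K ∧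
        (∀ g g' : (X.pow m).G, π (g * g') = π g + π g') ∧
        (∀ p u, 0 ≤ χ p u) ∧
        (∀ u, ∑ p, χ p u = 1) ∧
        (∀ p u (v : I → ℤ), χ p (u + fun i => (v i : ℝ)) = χ p u) ∧
        (∀ p u u', |χ p u - χ p u'| ≤ K * dist u u') ∧
        (∀ p u (v : I → ℤ), ∃ γ ∈ (X.pow m).Γ, σ p (u + fun i => (v i : ℝ)) = σ p u * γ) ∧
        (∀ p u u', dist u u' ≤ 1 →
          (X.pow m).dist (σ p u : (X.pow m).G ⧸ (X.pow m).Γ) (σ p u' : (X.pow m).G ⧸ (X.pow m).Γ) ≤ K * dist u u') ∧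
        (∀ p w, ζ p w ∈ Subgroup.center (X.pow m).G) ∧
        (∀ p w, χ p (π w) ≠ 0 → ∃ γ ∈ (X.pow m).Γ, w = ζ p w * σ p (π w) * γ) ∧
        (∀ p (g x₀ : (X.pow m).G) (n h₁ h₂ h₃ : ℤ),
          (∀ e₁ e₂ e₃ : ℕ, e₁ ≤ 1 → e₂ ≤ 1 → e₃ ≤ 1 →
            χ p (π (g ^ (n + e₁ * h₁ + e₂ * h₂ + e₃ * h₃) * x₀)) ≠ 0) →
          ζ p (g ^ (n + h₁ + h₂ + h₃) * x₀) * (ζ p (g ^ (n + h₁ + h₂) * x₀))⁻¹ *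
            (ζ p (g ^ (n + h₁ + h₃) * x₀))⁻¹ * (ζ p (g ^ (n + h₂ + h₃) * x₀))⁻¹ *
            ζ p (g ^ (n + h₁) * x₀) * ζ p (g ^ (n + h₂) * x₀) * ζ p (g ^ (n + h₃) * x₀) *
            (ζ p (g ^ n * x₀))⁻¹ = 1)
  | 0 => bracketFrame_point s
  | m + 1 => bracketFrame_prod X (X.pow m) hX (bracketFrame_pow X hX m)

/-- **Every member of the Heisenberg class `𝒞₂(H_d)` carries a bracket frame** (induction over
the class: the Heisenberg generator, the circle, binary products).
[cite: GreenTao2008QuadraticMobius, App. A, Prop. 5] -/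
theorem bracketFrame_of_inHeisClass (d : HX → HX → ℝ) (h : IsCompatMetric d)
    (hd : IsBoxComparable d) (X : Nilmanifold 2) (hX : InHeisClass (heisenbergWith d h) X) :
    ∃ (I : Type) (_ : Fintype I) (P : Type) (_ : Fintype P)
        (π : (X).G → (I → ℝ)) (χ : P → (I → ℝ) → ℝ) (σ : P → (I → ℝ) → (X).G)
        (ζ : P → (X).G → (X).G) (K : ℝ), 0 ≤ K ∧
        (∀ g g' : (X).G, π (g * g') = π g + π g') ∧
        (∀ p u, 0 ≤ χ p u) ∧
        (∀ u, ∑ p, χ p u = 1) ∧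
        (∀ p u (v : I → ℤ), χ p (u + fun i => (v i : ℝ)) = χ p u) ∧
        (∀ p u u', |χ p u - χ p u'| ≤ K * dist u u') ∧
        (∀ p u (v : I → ℤ), ∃ γ ∈ (X).Γ, σ p (u + fun i => (v i : ℝ)) = σ p u * γ) ∧
        (∀ p u u', dist u u' ≤ 1 →
          (X).dist (σ p u : (X).G ⧸ (X).Γ) (σ p u' : (X).G ⧸ (X).Γ) ≤ K * dist u u') ∧
        (∀ p w, ζ p w ∈ Subgroup.center (X).G) ∧
        (∀ p w, χ p (π w) ≠ 0 → ∃ γ ∈ (X).Γ, w = ζ p w * σ p (π w) * γ) ∧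
        (∀ p (g x₀ : (X).G) (n h₁ h₂ h₃ : ℤ),
          (∀ e₁ e₂ e₃ : ℕ, e₁ ≤ 1 → e₂ ≤ 1 → e₃ ≤ 1 →
            χ p (π (g ^ (n + e₁ * h₁ + e₂ * h₂ + e₃ * h₃) * x₀)) ≠ 0) →
          ζ p (g ^ (n + h₁ + h₂ + h₃) * x₀) * (ζ p (g ^ (n + h₁ + h₂) * x₀))⁻¹ *
            (ζ p (g ^ (n + h₁ + h₃) * x₀))⁻¹ * (ζ p (g ^ (n + h₂ + h₃) * x₀))⁻¹ *
            ζ p (g ^ (n + h₁) * x₀) * ζ p (g ^ (n + h₂) * x₀) * ζ p (g ^ (n + h₃) * x₀) *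
            (ζ p (g ^ n * x₀))⁻¹ = 1) := by
  induction hX with
  | heis => exact bracketFrame_heisenbergWith d h hd
  | circle => exact bracketFrame_ofLE Nilmanifold.circle _ bracketFrame_circle
  | prod _ _ ihX ihY => exact bracketFrame_prod _ _ ihX ihY

/-- **Bracket frames for the vertical class**: every `X^m × ℝ/ℤ` with `X ∈ 𝒞₂(H_d)` — the
nilmanifolds of the `MNTwo` skeleton's `stub_mnVertical` — carries a bracket frame.
[cite: GreenTao2008QuadraticMobius, App. A, Prop. 5] -/
theorem bracketFrame_verticalClass (d : HX → HX → ℝ) (h : IsCompatMetric d)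
    (hd : IsBoxComparable d) (X : Nilmanifold 2) (hX : InHeisClass (heisenbergWith d h) X) (m : ℕ) :
    ∃ (I : Type) (_ : Fintype I) (P : Type) (_ : Fintype P)
        (π : ((X.pow m).prod (Nilmanifold.circle.ofLE one_le_two)).G → (I → ℝ)) (χ : P → (I → ℝ) → ℝ) (σ : P → (I → ℝ) → ((X.pow m).prod (Nilmanifold.circle.ofLE one_le_two)).G)
        (ζ : P → ((X.pow m).prod (Nilmanifold.circle.ofLE one_le_two)).G → ((X.pow m).prod (Nilmanifold.circle.ofLE one_le_two)).G) (K : ℝ), 0 ≤ K ∧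
        (∀ g g' : ((X.pow m).prod (Nilmanifold.circle.ofLE one_le_two)).G, π (g * g') = π g + π g') ∧
        (∀ p u, 0 ≤ χ p u) ∧
        (∀ u, ∑ p, χ p u = 1) ∧
        (∀ p u (v : I → ℤ), χ p (u + fun i => (v i : ℝ)) = χ p u) ∧
        (∀ p u u', |χ p u - χ p u'| ≤ K * dist u u') ∧
        (∀ p u (v : I → ℤ), ∃ γ ∈ ((X.pow m).prod (Nilmanifold.circle.ofLE one_le_two)).Γ, σ p (u + fun i => (v i : ℝ)) = σ p u * γ) ∧
        (∀ p u u', dist u u' ≤ 1 →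
          ((X.pow m).prod (Nilmanifold.circle.ofLE one_le_two)).dist (σ p u : ((X.pow m).prod (Nilmanifold.circle.ofLE one_le_two)).G ⧸ ((X.pow m).prod (Nilmanifold.circle.ofLE one_le_two)).Γ) (σ p u' : ((X.pow m).prod (Nilmanifold.circle.ofLE one_le_two)).G ⧸ ((X.pow m).prod (Nilmanifold.circle.ofLE one_le_two)).Γ) ≤ K * dist u u') ∧
        (∀ p w, ζ p w ∈ Subgroup.center ((X.pow m).prod (Nilmanifold.circle.ofLE one_le_two)).G) ∧
        (∀ p w, χ p (π w) ≠ 0 → ∃ γ ∈ ((X.pow m).prod (Nilmanifold.circle.ofLE one_le_two)).Γ, w = ζ p w * σ p (π w) * γ) ∧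
        (∀ p (g x₀ : ((X.pow m).prod (Nilmanifold.circle.ofLE one_le_two)).G) (n h₁ h₂ h₃ : ℤ),
          (∀ e₁ e₂ e₃ : ℕ, e₁ ≤ 1 → e₂ ≤ 1 → e₃ ≤ 1 →
            χ p (π (g ^ (n + e₁ * h₁ + e₂ * h₂ + e₃ * h₃) * x₀)) ≠ 0) →
          ζ p (g ^ (n + h₁ + h₂ + h₃) * x₀) * (ζ p (g ^ (n + h₁ + h₂) * x₀))⁻¹ *
            (ζ p (g ^ (n + h₁ + h₃) * x₀))⁻¹ * (ζ p (g ^ (n + h₂ + h₃) * x₀))⁻¹ *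
            ζ p (g ^ (n + h₁) * x₀) * ζ p (g ^ (n + h₂) * x₀) * ζ p (g ^ (n + h₃) * x₀) *
            (ζ p (g ^ n * x₀))⁻¹ = 1) :=
  bracketFrame_prod _ _ (bracketFrame_pow X (bracketFrame_of_inHeisClass d h hd X hX) m)
    (bracketFrame_ofLE Nilmanifold.circle _ bracketFrame_circle)

end Summit.Parity.GeneralizedHardyLittlewood.GreenTaoLevelTwoMNTwoBracketFrameVertical
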